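import Mathlib
import HarnessLib
import Summits.HubbardSuperconductivity.HubbardSuperconductivity.Theorems.KLProgrammeKLRegimeTwoVolumeLipDoubledTruncStepLink
import Summits.HubbardSuperconductivity.HubbardSuperconductivity.Theorems.KLProgrammeKLRegimeTwoVolumeLipBudgetStep

/-!
# Route `KLProgramme` — crux K3 ENGINE (stmt-HubbardSuperconductivity-20437 `KLRegimeEngineV17F2`), stub (e) proof-input «(e)-D-ROWS», keying (A′), REKEY-D file D8T:
# THE TRUNCATED-DOUBLED TWO-VOLUME BLOCK STEP IN BUDGET FORM (`…EngineTowerLipschitzStepImage.lipStepImage_le_of_three_le′ / _low′` ∘ the LINK⁺)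
# (seat hubbard-kl-k3c4-p1 g28; truncated-doubled twin of ✓ `…TwoVolumeLipBudgetStep` over ✓/⧗ D5T-c `klLipBornDiffSupDT_le_kitStep_of_bounds`; `--supports` 23356)

* **`klLipBornDiffSupDT_le_budgetStep_of_three_le`** (degrees `p ≥ 3`), **`klLipBornDiffSupDT_le_budgetStep_low`** (every `p ≥ 1`): the LINK⁺'s data verbatim (labels `SrcLabel`,
  sups `klLipBornDiffSupDT/klLipInputDiffSupDT`, measured sizes `klLipInputMeasDT` at both volumes, `cW ≥ 1`), the budgeted four-piece profiles of the difference array and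
  of the majorant, the soft kit conditions at `σ̄ τ̄ ψ̄ Φ̄`; conclusion `≤ R·C_p + SRC/(ε·klLevUnitF β M 0 p (dk))`.

Compositions of landed theorems and real algebra (proofs = the sector twins'); nothing asserts the (D) rows, stub (e), VL, K3 or superconductivity.
References: BGM 2006 §2.8 (2.93)–(2.98), §2.9 (4.3)–(4.6), §3 [cite: BenfattoGiulianiMastropietro2006].
-/

noncomputable section

namespace Summit.HubbardSuperconductivity.HubbardSuperconductivity.Theorems.TwoVolumeLip

set_option linter.dupNamespace false -- summit = problem name (single-conjunct summit), D-0017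

open Finset Literature.MathematicalPhysics.QuantumLattice GrassmannAlgebra Literature.Probability.LatticeModels
  Literature.Probability.LatticeModels.BattleFederbush
open Literature.MathematicalPhysics.QuantumLattice.FermiRG
open Summit.HubbardSuperconductivity.HubbardSuperconductivity.Theorems.KLRegimeSplit
open Summit.HubbardSuperconductivity.HubbardSuperconductivity.Theorems.KLProgrammeLegKernels
open Summit.HubbardSuperconductivity.HubbardSuperconductivity.Theorems.DispersionFlow
open Summit.HubbardSuperconductivity.HubbardSuperconductivity.Theorems.EngineV8
open Summit.HubbardSuperconductivity.HubbardSuperconductivity.Theorems.TwoVolumeSource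
open Summit.HubbardSuperconductivity.HubbardSuperconductivity.Theorems.TwoVolumeDefect

variable {L b M : ℕ} [NeZero L] [NeZero (b * L)] [NeZero M]

set_option maxHeartbeats 1600000 in -- large statement
/-- **The truncated-doubled two-volume block step in BUDGET form, degrees `p ≥ 3`** (twin of ✓ `klLipBornDiffSup_le_budgetStep_of_three_le` over the LINK⁺ D5T-c) (`…EngineTowerLipschitzStepImage.lipStepImage_le_of_three_le'` ∘ the LINK): block `k ≥ 1`, the LINK's data verbatim; if the scaled difference array `dμ` of the block has the budgeted four-piece profile `R·(κ₁λ, κ₂λ, κ₃λ², Aνλ^{m−1}Q′^m)` and the majorant `μb` the four-piece profile `(ι₁λ, ι₂λ, ι₃λ², A′λ^{m−1}Q′^m)`, then under the soft kit conditions at the LINK's constants `σ̄ τ̄ ψ̄ Φ̄` the born difference in floor units is `≤ R·C_p + SRC/(ε·klLevUnitF β M 0 p (dk))` with the explicit `C_p` of `lipStepImage_le_of_three_le'`. -/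
theorem klLipBornDiffSupDT_le_budgetStep_of_three_le {β : ℝ} (hβ : 0 < β) (U μ : ℝ) (K : TrigPolyC4v) {d k : ℕ} (jw : ℕ) (hd : 1 ≤ d) (hk : 1 ≤ k)
    (hZf : hubbardEffPartitionFnCT (b * L) M β U μ 0 K (klScale klE0 (d * k)) ≠ 0)
    (hZc : hubbardEffPartitionFnCT L M β U μ 0 K (klScale klE0 (d * k)) ≠ 0)
    {κ κb : ℝ} (hκ : 0 < κ) (hκb : 0 < κb) (hκκb : κ ^ 2 * (8 : ℝ) ^ (d * k) ≤ κb ^ 2)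
    (hGB : IsGramBoundedR ((sectorSubMatrix (b * L) M β (bgmFatMultiplier (b * L) M klE0 β (nambuXiCT (b * L) μ K) (d * k - 1))).transpose * hubbardCovSliceCT (b * L) M β μ 0 K (klScale klE0 (d * (k + 1))) (klScale klE0 (d * k)) * sectorSubMatrix (b * L) M β (bgmFatMultiplier (b * L) M klE0 β (nambuXiCT (b * L) μ K) (d * k - 1))) κ)
    {α αb : ℝ} (hαb : 0 < αb) (hααb : α ≤ αb * (4 : ℝ) ^ (d * k))
    (hrow : ∀ X, ∑ Y, ‖((sectorSubMatrix (b * L) M β (bgmFatMultiplier (b * L) M klE0 β (nambuXiCT (b * L) μ K) (d * k - 1))).transpose * hubbardCovSliceCT (b * L) M β μ 0 K (klScale klE0 (d * (k + 1))) (klScale klE0 (d * k)) * sectorSubMatrix (b * L) M β (bgmFatMultiplier (b * L) M klE0 β (nambuXiCT (b * L) μ K) (d * k - 1))) X Y‖ * klGluedWt L b M β jw (sectorCount (d * k - 1)) {X, Y} ≤ α)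
    (hcol : ∀ Y, ∑ X, ‖((sectorSubMatrix (b * L) M β (bgmFatMultiplier (b * L) M klE0 β (nambuXiCT (b * L) μ K) (d * k - 1))).transpose * hubbardCovSliceCT (b * L) M β μ 0 K (klScale klE0 (d * (k + 1))) (klScale klE0 (d * k)) * sectorSubMatrix (b * L) M β (bgmFatMultiplier (b * L) M klE0 β (nambuXiCT (b * L) μ K) (d * k - 1))) X Y‖ * klGluedWt L b M β jw (sectorCount (d * k - 1)) {X, Y} ≤ α)
    {D : ℕ} (hD : Fintype.card (SrcLabel (b * L) M (d * k - 1)) / 2 ≤ D)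
    (Rin R' : ℕ) {Λ : ℝ} (hΛ1 : 1 ≤ Λ) (hΛle : Λ ≤ 1 + klScale klE0 jw * ((R' : ℝ) + 1))
    (jr : ℕ) {ΛT cW : ℝ} (hΛT : 0 ≤ ΛT) (hΛr : ΛT ≤ klScale klE0 jr) (hcW1 : 1 ≤ cW)
    (hrowT : ∀ x, ∑ y', ‖klLipTransfer (b * L) M β μ K d k x y'‖ *
      klScaleWt (b * L) M β jr {latticeLegPos (2 * (2 * M)) x, latticeLegPos (2 * (2 * M)) y'} ≤ cW)
    (hcolT : ∀ y', ∑ x, ‖klLipTransfer (b * L) M β μ K d k x y'‖ *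
      klScaleWt (b * L) M β jr {latticeLegPos (2 * (2 * M)) x, latticeLegPos (2 * (2 * M)) y'} ≤ cW)
    (D₀ r : ℕ) (hD₀ : 2 * r ≤ D₀) (hRR' : Rin + R' ≤ D₀)
    {n p : ℕ} (hq : 2 * p = n + 1)
    {N Nfar Es NDs : ℝ} (hN0 : 0 ≤ N) (hNfar0 : 0 ≤ Nfar) (hEs0 : 0 ≤ Es) (hNDs0 : 0 ≤ NDs)
    (hN : ∀ (q : Fin (n + 1)) y, ∑ Y ∈ univ.filter (fun Y : Fin (n + 1) → SrcLabel L M (d * k - 1) => Y q = y),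
      ‖kernel ℂ (effAction ℂ (klLipCovD L M β μ K d k) (klLipInputDT L M β U μ K d k) - klLipInputDT L M β U μ K d k) (n + 1) Y‖ ≤ N)
    (hNfar : ∀ (q : Fin (n + 1)) y (i : Fin (n + 1)),
      ∑ Y ∈ univ.filter (fun Y : Fin (n + 1) → SrcLabel L M (d * k - 1) => Y q = y ∧ r < Torus.tnorm ((Y q).1.1.2 - (Y i).1.1.2)),
        ‖kernel ℂ (effAction ℂ (klLipCovD L M β μ K d k) (klLipInputDT L M β U μ K d k) - klLipInputDT L M β U μ K d k) (n + 1) Y‖ ≤ Nfar)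
    (hEs : ∀ (q : Fin (n + 1)) (y' : SrcLabel (b * L) M (d * k - 1)), y' ∈ klDeepPinsD (V := b * L) (M := M) (n := d * k - 1) L D₀ →
      ∑ Y' ∈ univ.filter (fun Y' : Fin (n + 1) → SrcLabel (b * L) M (d * k - 1) => Y' q = y'),
        ‖kernel ℂ ((effAction ℂ (klLipCovD (b * L) M β μ K d k) (klGlueD L b M (d * k - 1) (klLipInputDT L M β U μ K d k)) -
              klGlueD L b M (d * k - 1) (klLipInputDT L M β U μ K d k)) -
            klGlueD L b M (d * k - 1)
              (effAction ℂ (klLipCovD L M β μ K d k) (klLipInputDT L M β U μ K d k) - klLipInputDT L M β U μ K d k)) (n + 1) Y'‖ ≤ Es)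
    (hNDs : ∀ (q : Fin (n + 1)) (y' : SrcLabel (b * L) M (d * k - 1)),
      ∑ Y' ∈ univ.filter (fun Y' : Fin (n + 1) → SrcLabel (b * L) M (d * k - 1) => Y' q = y'),
        ‖kernel ℂ ((effAction ℂ (klLipCovD (b * L) M β μ K d k) (klGlueD L b M (d * k - 1) (klLipInputDT L M β U μ K d k)) -
              klGlueD L b M (d * k - 1) (klLipInputDT L M β U μ K d k)) -
            klGlueD L b M (d * k - 1)
              (effAction ℂ (klLipCovD L M β μ K d k) (klLipInputDT L M β U μ K d k) - klLipInputDT L M β U μ K d k)) (n + 1) Y'‖ ≤ NDs)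
    (hp3 : 3 ≤ p)
    -- the majorant's four-piece profile (one-volume, E1) and the budgeted profile of the difference array at this block
    {lam Q' A' ι₁ ι₂ ι₃ Aν κ₁ κ₂ κ₃ R : ℝ} (hlam : 0 < lam) (hQ' : 0 < Q') (hA' : 0 ≤ A') (hAν : 0 ≤ Aν) (hR : 0 ≤ R)
    (hι₁ : (fun m => 32 * ((cW ^ 2 / 8) ^ m * (klLipInputMeasDT L M β U μ K d k jw (2 * m) / klLevUnitF β M 0 m (d * k - 1) + (klLipInputMeasDT (b * L) M β U μ K d k jw (2 * m) / klLevUnitF β M 0 m (d * k - 1) + klLipInputMeasDT L M β U μ K d k jw (2 * m) / klLevUnitF β M 0 m (d * k - 1)) + klLipInputDiffSupDT L b M β U μ K d k (2 * m) Rin / (imagTimeWeight β M * klLevUnitF β M 0 m (d * k - 1))))) 1 ≤ ι₁ * lam) (hι₂ : (fun m => 32 * ((cW ^ 2 / 8) ^ m * (klLipInputMeasDT L M β U μ K d k jw (2 * m) / klLevUnitF β M 0 m (d * k - 1) + (klLipInputMeasDT (b * L) M β U μ K d k jw (2 * m) / klLevUnitF β M 0 m (d * k - 1) + klLipInputMeasDT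 L M β U μ K d k jw (2 * m) / klLevUnitF β M 0 m (d * k - 1)) + klLipInputDiffSupDT L b M β U μ K d k (2 * m) Rin / (imagTimeWeight β M * klLevUnitF β M 0 m (d * k - 1))))) 2 ≤ ι₂ * lam) (hι₃ : (fun m => 32 * ((cW ^ 2 / 8) ^ m * (klLipInputMeasDT L M β U μ K d k jw (2 * m) / klLevUnitF β M 0 m (d * k - 1) + (klLipInputMeasDT (b * L) M β U μ K d k jw (2 * m) / klLevUnitF β M 0 m (d * k - 1) + klLipInputMeasDT L M β U μ K d k jw (2 * m) / klLevUnitF β M 0 m (d * k - 1)) + klLipInputDiffSupDT L b M β U μ K d k (2 * m) Rin / (imagTimeWeight β M * klLevUnitF β M 0 m (d * k - 1))))) 3 ≤ ι₃ * lam ^ 2)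
    (hprofb : ∀ m, 4 ≤ m → m ≤ D → (fun m => 32 * ((cW ^ 2 / 8) ^ m * (klLipInputMeasDT L M β U μ K d k jw (2 * m) / klLevUnitF β M 0 m (d * k - 1) + (klLipInputMeasDT (b * L) M β U μ K d k jw (2 * m) / klLevUnitF β M 0 m (d * k - 1) + klLipInputMeasDT L M β U μ K d k jw (2 * m) / klLevUnitF β M 0 m (d * k - 1)) + klLipInputDiffSupDT L b M β U μ K d k (2 * m) Rin / (imagTimeWeight β M * klLevUnitF β M 0 m (d * k - 1))))) m ≤ A' * lam ^ (m - 1) * Q' ^ m)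
    (hν₁ : (fun m => 32 * ((cW ^ 2 / 8) ^ m * (klLipInputDiffSupDT L b M β U μ K d k (2 * m) Rin / (imagTimeWeight β M * klLevUnitF β M 0 m (d * k - 1)) + (Λ⁻¹ + 1 / (1 + ΛT * ((r : ℝ) + 1))) * (klLipInputMeasDT (b * L) M β U μ K d k jw (2 * m) / klLevUnitF β M 0 m (d * k - 1) + klLipInputMeasDT L M β U μ K d k jw (2 * m) / klLevUnitF β M 0 m (d * k - 1))))) 1 ≤ R * (κ₁ * lam)) (hν₂ : (fun m => 32 * ((cW ^ 2 / 8) ^ m * (klLipInputDiffSupDT L b M β U μ K d k (2 * m) Rin / (imagTimeWeight β M * klLevUnitF β M 0 m (d * k - 1)) + (Λ⁻¹ + 1 / (1 + ΛT * ((r : ℝ) + 1))) * (klLipInputMeasDT (b * L) M β U μ K d k jw (2 * m) / klLevUnitF β M 0 m (d * k - 1) + klLipInputMeasDT L M β U μ K d k jw (2 * m) / klLevUnitF β M 0 m (d * k - 1))))) 2 ≤ R * (κ₂ * lam)) (hν₃ : (fun m => 32 * ((cW ^ 2 / 8) ^ m * (klLipInputDiffSupDT L b M β U μ K d k (2 *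 m) Rin / (imagTimeWeight β M * klLevUnitF β M 0 m (d * k - 1)) + (Λ⁻¹ + 1 / (1 + ΛT * ((r : ℝ) + 1))) * (klLipInputMeasDT (b * L) M β U μ K d k jw (2 * m) / klLevUnitF β M 0 m (d * k - 1) + klLipInputMeasDT L M β U μ K d k jw (2 * m) / klLevUnitF β M 0 m (d * k - 1))))) 3 ≤ R * (κ₃ * lam ^ 2))
    (hνprof : ∀ m, 4 ≤ m → m ≤ D → (fun m => 32 * ((cW ^ 2 / 8) ^ m * (klLipInputDiffSupDT L b M β U μ K d k (2 * m) Rin / (imagTimeWeight β M * klLevUnitF β M 0 m (d * k - 1)) + (Λ⁻¹ + 1 / (1 + ΛT * ((r : ℝ) + 1))) * (klLipInputMeasDT (b * L) M β U μ K d k jw (2 * m) / klLevUnitF β M 0 m (d * k - 1) + klLipInputMeasDT L M β U μ K d k jw (2 * m) / klLevUnitF β M 0 m (d * k - 1))))) m ≤ R * (Aν * lam ^ (m - 1) * Q' ^ m))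
    -- the soft kit conditions at the LINK's constants
    (hx₁ : 4 * (κb ^ 2 * imagTimeWeight β M ^ 2 / cW ^ 2) * lam * Q' < 1) (hx₂ : 2 * lam * (4 * Real.exp 4 * κb ^ 2 * imagTimeWeight β M ^ 2 / cW ^ 2) * Q' ≤ 1) (hx₃ : Real.exp 1 * (4 * Real.exp 4 * κb ^ 2 * imagTimeWeight β M ^ 2 / cW ^ 2) * lam * Q' < 1)
    (hy : (Real.exp 1 * αb / κb ^ 2) * ((4 * Real.exp 4 * κb ^ 2 * imagTimeWeight β M ^ 2 / cW ^ 2) * (ι₁ * lam + ι₂ / (2 * Q') + ι₃ / (4 * Q' ^ 2) + A' * Q' / 4)) < 1)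
    (hθ : (Real.exp 1 * αb / κb ^ 2) * (Real.exp 1 * (4 * Real.exp 4 * κb ^ 2 * imagTimeWeight β M ^ 2 / cW ^ 2) * (ι₁ * lam) + (Real.exp 1 * (4 * Real.exp 4 * κb ^ 2 * imagTimeWeight β M ^ 2 / cW ^ 2)) ^ 2 * (ι₂ * lam) + (Real.exp 1 * (4 * Real.exp 4 * κb ^ 2 * imagTimeWeight β M ^ 2 / cW ^ 2)) ^ 3 * (ι₃ * lam ^ 2) + A' * (Real.exp 1 * (4 * Real.exp 4 * κb ^ 2 * imagTimeWeight β M ^ 2 / cW ^ 2) * Q') * ((Real.exp 1 * (4 * Real.exp 4 * κb ^ 2 * imagTimeWeight β M ^ 2 / cW ^ 2) * lam * Q') ^ 3 / (1 - Real.exp 1 * (4 * Real.exp 4 * κb ^ 2 * imagTimeWeight β M ^ 2 / cW ^ 2) * lam * Q'))) < 1) :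
    klLipBornDiffSupDT L b M β U μ K d k (n + 1) (D₀ + r) / (imagTimeWeight β M * klLevUnitF β M 0 p (d * k)) ≤
      R * (Aν * lam ^ (p - 1) * (4 * Q') ^ p * (4 * (κb ^ 2 * imagTimeWeight β M ^ 2 / cW ^ 2) * lam * Q' / (1 - 4 * (κb ^ 2 * imagTimeWeight β M ^ 2 / cW ^ 2) * lam * Q')) +
        Real.exp 1 * (cW ^ 2 / (κb ^ 2 * imagTimeWeight β M ^ 2)) ^ p * (2 * (4 * Real.exp 4 * κb ^ 2 * imagTimeWeight β M ^ 2 / cW ^ 2) * Q' * lam) ^ (p - 1) * ((4 * Real.exp 4 * κb ^ 2 * imagTimeWeight β M ^ 2 / cW ^ 2) * (κ₁ * lam + κ₂ / (2 * Q') + κ₃ / (4 * Q' ^ 2) + Aν * Q' / 4)) *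
          ((2 * ((Real.exp 1 * αb / κb ^ 2) * ((4 * Real.exp 4 * κb ^ 2 * imagTimeWeight β M ^ 2 / cW ^ 2) * (ι₁ * lam + ι₂ / (2 * Q') + ι₃ / (4 * Q' ^ 2) + A' * Q' / 4))) - ((Real.exp 1 * αb / κb ^ 2) * ((4 * Real.exp 4 * κb ^ 2 * imagTimeWeight β M ^ 2 / cW ^ 2) * (ι₁ * lam + ι₂ / (2 * Q') + ι₃ / (4 * Q' ^ 2) + A' * Q' / 4))) ^ 2) / (1 - (Real.exp 1 * αb / κb ^ 2) * ((4 * Real.exp 4 * κb ^ 2 * imagTimeWeight β M ^ 2 / cW ^ 2) * (ι₁ * lam + ι₂ / (2 * Q') + ι₃ / (4 * Q' ^ 2) + A' * Q' / 4))) ^ 2)) +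
      (cW ^ n * (cW * Es + cW / (1 + ΛT * ((r : ℝ) + 1)) * NDs) + (2 * cW ^ n * (cW / (1 + ΛT * ((r : ℝ) + 1))) * N + n * cW ^ n * (5 * (cW / (1 + ΛT * ((r : ℝ) + 1))) * N + 2 * cW * Nfar))) / (imagTimeWeight β M * klLevUnitF β M 0 p (d * k)) := by
  have hlink := fun (N' : ℕ) (hN' : 2 ≤ N') (hg : (Real.exp 1 * αb / κb ^ 2) * towerV D (4 * Real.exp 4 * κb ^ 2 * imagTimeWeight β M ^ 2 / cW ^ 2) (fun m => 32 * ((cW ^ 2 / 8) ^ m * (klLipInputMeasDT L M β U μ K d k jw (2 * m) / klLevUnitF β M 0 m (d * k - 1) + (klLipInputMeasDT (b * L) M β U μ K d k jw (2 * m) / klLevUnitF β M 0 m (d * k - 1) + klLipInputMeasDT L M β U μ K d k jw (2 * m) / klLevUnitF β M 0 m (d * k - 1)) + klLipInputDiffSupDT L b M β U μ K d k (2 * m) Rin / (imagTimeWeight β M * klLevUnitF β M 0 m (d * k - 1))))) < 1) =>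
    klLipBornDiffSupDT_le_kitStep_of_bounds (L := L) (b := b) (M := M) hβ U μ K jw hd hk hZf hZc hκ hκb hκκb hGB hαb hααb hrow hcol hD Rin R' hΛ1 hΛle
      jr hΛT hΛr hcW1 hrowT hcolT D₀ r hD₀ hRR' hq hN0 hNfar0 hEs0 hNDs0 hN hNfar hEs hNDs (Nt := N') (by omega) hg
  have hx : 0 < imagTimeWeight β M := imagTimeWeight_pos_of_pos (M := M) hβ
  have hΛinv : 0 ≤ Λ⁻¹ := inv_nonneg.2 (zero_le_one.trans hΛ1)
  have hν0 : ∀ m, 0 ≤ (fun m => 32 * ((cW ^ 2 / 8) ^ m * (klLipInputDiffSupDT L b M β U μ K d k (2 * m) Rin / (imagTimeWeight β M * klLevUnitF β M 0 m (d * k - 1)) + (Λ⁻¹ + 1 / (1 + ΛT * ((r : ℝ) + 1))) * (klLipInputMeasDT (b * L) M β U μ K d k jw (2 * m) / klLevUnitF β M 0 m (d * k - 1) + klLipInputMeasDT L M β U μ K d k jw (2 * m) / klLevUnitF β M 0 m (d * k - 1))))) m := fun m => by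
    have h1 := klLipInputDiffSupDT_nonneg (L := L) (b := b) (M := M) β U μ K d k (2 * m) Rin
    have h2 := klLipInputMeasDT_nonneg hβ.le U μ K d k jw (2 * m) (V := b * L) (M := M)
    have h3 := klLipInputMeasDT_nonneg hβ.le U μ K d k jw (2 * m) (V := L) (M := M)
    have h4 := klLevUnitF_pos hβ (M := M) 0 m (d * k - 1)
    have h5 : 0 ≤ cW := zero_le_one.trans hcW1
    positivity
  have hμ0 : ∀ m, 0 ≤ (fun m => 32 * ((cW ^ 2 / 8) ^ m * (klLipInputMeasDT L M β U μ K d k jw (2 * m) / klLevUnitF β M 0 m (d * k - 1) + (klLipInputMeasDT (b * L) M β U μ K d k jw (2 * m) / klLevUnitF β M 0 m (d * k - 1) + klLipInputMeasDT L M β U μ K d k jw (2 * m) / klLevUnitF β M 0 m (d * k - 1)) + klLipInputDiffSupDT L b M β U μ K d k (2 * m) Rin / (imagTimeWeight β M * klLevUnitF β M 0 m (d * k - 1))))) m := fun m => by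
    have h1 := klLipInputDiffSupDT_nonneg (L := L) (b := b) (M := M) β U μ K d k (2 * m) Rin
    have h2 := klLipInputMeasDT_nonneg hβ.le U μ K d k jw (2 * m) (V := b * L) (M := M)
    have h3 := klLipInputMeasDT_nonneg hβ.le U μ K d k jw (2 * m) (V := L) (M := M)
    have h4 := klLevUnitF_pos hβ (M := M) 0 m (d * k - 1)
    have h5 : 0 ≤ cW := zero_le_one.trans hcW1
    positivity
  exact lipStepImage_le_of_three_le' (D := D) hp3 (by positivity) (by positivity) (by positivity) (by positivity) (by norm_num) hlam hQ' hA' hAν hR hν0 hμ0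
    hι₁ hι₂ hι₃ hprofb hν₁ hν₂ hν₃ hνprof hx₁ hx₂ hx₃ hy hθ hlink

set_option maxHeartbeats 1600000 in -- large statement
/-- **The truncated-doubled two-volume block step in BUDGET form, every degree `p ≥ 1`** (twin of ✓ `klLipBornDiffSup_le_budgetStep_low` over the LINK⁺ D5T-c) (`lipStepImage_le_low'` ∘ the LINK; the graded part is `O(λ²)` — used in the degrees `p = 1, 2`). -/
theorem klLipBornDiffSupDT_le_budgetStep_low {β : ℝ} (hβ : 0 < β) (U μ : ℝ) (K : TrigPolyC4v) {d k : ℕ} (jw : ℕ) (hd : 1 ≤ d) (hk : 1 ≤ k)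
    (hZf : hubbardEffPartitionFnCT (b * L) M β U μ 0 K (klScale klE0 (d * k)) ≠ 0)
    (hZc : hubbardEffPartitionFnCT L M β U μ 0 K (klScale klE0 (d * k)) ≠ 0)
    {κ κb : ℝ} (hκ : 0 < κ) (hκb : 0 < κb) (hκκb : κ ^ 2 * (8 : ℝ) ^ (d * k) ≤ κb ^ 2)
    (hGB : IsGramBoundedR ((sectorSubMatrix (b * L) M β (bgmFatMultiplier (b * L) M klE0 β (nambuXiCT (b * L) μ K) (d * k - 1))).transpose * hubbardCovSliceCT (b * L) M β μ 0 K (klScale klE0 (d * (k + 1))) (klScale klE0 (d * k)) * sectorSubMatrix (b * L) M β (bgmFatMultiplier (b * L) M klE0 β (nambuXiCT (b * L) μ K) (d * k - 1))) κ)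
    {α αb : ℝ} (hαb : 0 < αb) (hααb : α ≤ αb * (4 : ℝ) ^ (d * k))
    (hrow : ∀ X, ∑ Y, ‖((sectorSubMatrix (b * L) M β (bgmFatMultiplier (b * L) M klE0 β (nambuXiCT (b * L) μ K) (d * k - 1))).transpose * hubbardCovSliceCT (b * L) M β μ 0 K (klScale klE0 (d * (k + 1))) (klScale klE0 (d * k)) * sectorSubMatrix (b * L) M β (bgmFatMultiplier (b * L) M klE0 β (nambuXiCT (b * L) μ K) (d * k - 1))) X Y‖ * klGluedWt L b M β jw (sectorCount (d * k - 1)) {X, Y} ≤ α)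
    (hcol : ∀ Y, ∑ X, ‖((sectorSubMatrix (b * L) M β (bgmFatMultiplier (b * L) M klE0 β (nambuXiCT (b * L) μ K) (d * k - 1))).transpose * hubbardCovSliceCT (b * L) M β μ 0 K (klScale klE0 (d * (k + 1))) (klScale klE0 (d * k)) * sectorSubMatrix (b * L) M β (bgmFatMultiplier (b * L) M klE0 β (nambuXiCT (b * L) μ K) (d * k - 1))) X Y‖ * klGluedWt L b M β jw (sectorCount (d * k - 1)) {X, Y} ≤ α)
    {D : ℕ} (hD : Fintype.card (SrcLabel (b * L) M (d * k - 1)) / 2 ≤ D)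
    (Rin R' : ℕ) {Λ : ℝ} (hΛ1 : 1 ≤ Λ) (hΛle : Λ ≤ 1 + klScale klE0 jw * ((R' : ℝ) + 1))
    (jr : ℕ) {ΛT cW : ℝ} (hΛT : 0 ≤ ΛT) (hΛr : ΛT ≤ klScale klE0 jr) (hcW1 : 1 ≤ cW)
    (hrowT : ∀ x, ∑ y', ‖klLipTransfer (b * L) M β μ K d k x y'‖ *
      klScaleWt (b * L) M β jr {latticeLegPos (2 * (2 * M)) x, latticeLegPos (2 * (2 * M)) y'} ≤ cW)
    (hcolT : ∀ y', ∑ x, ‖klLipTransfer (b * L) M β μ K d k x y'‖ *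
      klScaleWt (b * L) M β jr {latticeLegPos (2 * (2 * M)) x, latticeLegPos (2 * (2 * M)) y'} ≤ cW)
    (D₀ r : ℕ) (hD₀ : 2 * r ≤ D₀) (hRR' : Rin + R' ≤ D₀)
    {n p : ℕ} (hq : 2 * p = n + 1)
    {N Nfar Es NDs : ℝ} (hN0 : 0 ≤ N) (hNfar0 : 0 ≤ Nfar) (hEs0 : 0 ≤ Es) (hNDs0 : 0 ≤ NDs)
    (hN : ∀ (q : Fin (n + 1)) y, ∑ Y ∈ univ.filter (fun Y : Fin (n + 1) → SrcLabel L M (d * k - 1) => Y q = y),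
      ‖kernel ℂ (effAction ℂ (klLipCovD L M β μ K d k) (klLipInputDT L M β U μ K d k) - klLipInputDT L M β U μ K d k) (n + 1) Y‖ ≤ N)
    (hNfar : ∀ (q : Fin (n + 1)) y (i : Fin (n + 1)),
      ∑ Y ∈ univ.filter (fun Y : Fin (n + 1) → SrcLabel L M (d * k - 1) => Y q = y ∧ r < Torus.tnorm ((Y q).1.1.2 - (Y i).1.1.2)),
        ‖kernel ℂ (effAction ℂ (klLipCovD L M β μ K d k) (klLipInputDT L M β U μ K d k) - klLipInputDT L M β U μ K d k) (n + 1) Y‖ ≤ Nfar)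
    (hEs : ∀ (q : Fin (n + 1)) (y' : SrcLabel (b * L) M (d * k - 1)), y' ∈ klDeepPinsD (V := b * L) (M := M) (n := d * k - 1) L D₀ →
      ∑ Y' ∈ univ.filter (fun Y' : Fin (n + 1) → SrcLabel (b * L) M (d * k - 1) => Y' q = y'),
        ‖kernel ℂ ((effAction ℂ (klLipCovD (b * L) M β μ K d k) (klGlueD L b M (d * k - 1) (klLipInputDT L M β U μ K d k)) -
              klGlueD L b M (d * k - 1) (klLipInputDT L M β U μ K d k)) -
            klGlueD L b M (d * k - 1)
              (effAction ℂ (klLipCovD L M β μ K d k) (klLipInputDT L M β U μ K d k) - klLipInputDT L M β U μ K d k)) (n + 1) Y'‖ ≤ Es)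
    (hNDs : ∀ (q : Fin (n + 1)) (y' : SrcLabel (b * L) M (d * k - 1)),
      ∑ Y' ∈ univ.filter (fun Y' : Fin (n + 1) → SrcLabel (b * L) M (d * k - 1) => Y' q = y'),
        ‖kernel ℂ ((effAction ℂ (klLipCovD (b * L) M β μ K d k) (klGlueD L b M (d * k - 1) (klLipInputDT L M β U μ K d k)) -
              klGlueD L b M (d * k - 1) (klLipInputDT L M β U μ K d k)) -
            klGlueD L b M (d * k - 1)
              (effAction ℂ (klLipCovD L M β μ K d k) (klLipInputDT L M β U μ K d k) - klLipInputDT L M β U μ K d k)) (n + 1) Y'‖ ≤ NDs)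
    -- the majorant's four-piece profile (one-volume, E1) and the budgeted profile of the difference array at this block
    {lam Q' A' ι₁ ι₂ ι₃ Aν κ₁ κ₂ κ₃ R : ℝ} (hlam : 0 < lam) (hQ' : 0 < Q') (hA' : 0 ≤ A') (hAν : 0 ≤ Aν) (hR : 0 ≤ R)
    (hκ₁0 : 0 ≤ κ₁) (hκ₂0 : 0 ≤ κ₂) (hκ₃0 : 0 ≤ κ₃)
    (hι₁ : (fun m => 32 * ((cW ^ 2 / 8) ^ m * (klLipInputMeasDT L M β U μ K d k jw (2 * m) / klLevUnitF β M 0 m (d * k - 1) + (klLipInputMeasDT (b * L) M β U μ K d k jw (2 * m) / klLevUnitF β M 0 m (d * k - 1) + klLipInputMeasDT L M β U μ K d k jw (2 * m) / klLevUnitF β M 0 m (d * k - 1)) + klLipInputDiffSupDT L b M β U μ K d k (2 * m) Rin / (imagTimeWeight β M * klLevUnitF β M 0 m (d * k - 1))))) 1 ≤ ι₁ * lam) (hι₂ : (fun m => 32 * ((cW ^ 2 / 8) ^ m * (klLipInputMeasDT L M β U μ K d k jw (2 * m) / klLevUnitF β M 0 m (d * k - 1) + (klLipInputMeasDT (b *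 L) M β U μ K d k jw (2 * m) / klLevUnitF β M 0 m (d * k - 1) + klLipInputMeasDT L M β U μ K d k jw (2 * m) / klLevUnitF β M 0 m (d * k - 1)) + klLipInputDiffSupDT L b M β U μ K d k (2 * m) Rin / (imagTimeWeight β M * klLevUnitF β M 0 m (d * k - 1))))) 2 ≤ ι₂ * lam) (hι₃ : (fun m => 32 * ((cW ^ 2 / 8) ^ m * (klLipInputMeasDT L M β U μ K d k jw (2 * m) / klLevUnitF β M 0 m (d * k - 1) + (klLipInputMeasDT (b * L) M β U μ K d k jw (2 * m) / klLevUnitF β M 0 m (d * k - 1) + klLipInputMeasDT L M β U μ K d k jw (2 * m) / klLevUnitF β M 0 m (d * k - 1)) + klLipInputDiffSupDT L b M β U μ K d k (2 * m) Rin / (imagTimeWeight β M * klLevUnitF β M 0 m (d * k - 1))))) 3 ≤ ι₃ * lam ^ 2)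
    (hprofb : ∀ m, 4 ≤ m → m ≤ D → (fun m => 32 * ((cW ^ 2 / 8) ^ m * (klLipInputMeasDT L M β U μ K d k jw (2 * m) / klLevUnitF β M 0 m (d * k - 1) + (klLipInputMeasDT (b * L) M β U μ K d k jw (2 * m) / klLevUnitF β M 0 m (d * k - 1) + klLipInputMeasDT L M β U μ K d k jw (2 * m) / klLevUnitF β M 0 m (d * k - 1)) + klLipInputDiffSupDT L b M β U μ K d k (2 * m) Rin / (imagTimeWeight β M * klLevUnitF β M 0 m (d * k - 1))))) m ≤ A' * lam ^ (m - 1) * Q' ^ m)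
    (hν₁ : (fun m => 32 * ((cW ^ 2 / 8) ^ m * (klLipInputDiffSupDT L b M β U μ K d k (2 * m) Rin / (imagTimeWeight β M * klLevUnitF β M 0 m (d * k - 1)) + (Λ⁻¹ + 1 / (1 + ΛT * ((r : ℝ) + 1))) * (klLipInputMeasDT (b * L) M β U μ K d k jw (2 * m) / klLevUnitF β M 0 m (d * k - 1) + klLipInputMeasDT L M β U μ K d k jw (2 * m) / klLevUnitF β M 0 m (d * k - 1))))) 1 ≤ R * (κ₁ * lam)) (hν₂ : (fun m => 32 * ((cW ^ 2 / 8) ^ m * (klLipInputDiffSupDT L b M β U μ K d k (2 * m) Rin / (imagTimeWeight β M * klLevUnitF β M 0 m (d * k - 1)) + (Λ⁻¹ + 1 / (1 + ΛT * ((r : ℝ) + 1))) * (klLipInputMeasDT (b * L) M β U μ K d k jw (2 * m) / klLevUnitF β M 0 m (d * k - 1) + klLipInputMeasDT L M β U μ K d k jw (2 * m) / klLevUnitF β M 0 m (d * k - 1))))) 2 ≤ R * (κ₂ * lam)) (hν₃ : (fun m => 32 * ((cW ^ 2 / 8) ^ m * (klLipInputDiffSupDT L b M β U μ K d k (2 *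 m) Rin / (imagTimeWeight β M * klLevUnitF β M 0 m (d * k - 1)) + (Λ⁻¹ + 1 / (1 + ΛT * ((r : ℝ) + 1))) * (klLipInputMeasDT (b * L) M β U μ K d k jw (2 * m) / klLevUnitF β M 0 m (d * k - 1) + klLipInputMeasDT L M β U μ K d k jw (2 * m) / klLevUnitF β M 0 m (d * k - 1))))) 3 ≤ R * (κ₃ * lam ^ 2))
    (hνprof : ∀ m, 4 ≤ m → m ≤ D → (fun m => 32 * ((cW ^ 2 / 8) ^ m * (klLipInputDiffSupDT L b M β U μ K d k (2 * m) Rin / (imagTimeWeight β M * klLevUnitF β M 0 m (d * k - 1)) + (Λ⁻¹ + 1 / (1 + ΛT * ((r : ℝ) + 1))) * (klLipInputMeasDT (b * L) M β U μ K d k jw (2 * m) / klLevUnitF β M 0 m (d * k - 1) + klLipInputMeasDT L M β U μ K d k jw (2 * m) / klLevUnitF β M 0 m (d * k - 1))))) m ≤ R * (Aν * lam ^ (m - 1) * Q' ^ m))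
    -- the soft kit conditions at the LINK's constants
    (hx₁ : 4 * (κb ^ 2 * imagTimeWeight β M ^ 2 / cW ^ 2) * lam * Q' < 1) (hx₃ : Real.exp 1 * (4 * Real.exp 4 * κb ^ 2 * imagTimeWeight β M ^ 2 / cW ^ 2) * lam * Q' < 1)
    (hy₁ : (Real.exp 1 * αb / κb ^ 2) * ((4 * Real.exp 4 * κb ^ 2 * imagTimeWeight β M ^ 2 / cW ^ 2) * (ι₁ * lam) + (4 * Real.exp 4 * κb ^ 2 * imagTimeWeight β M ^ 2 / cW ^ 2) ^ 2 * (ι₂ * lam) + (4 * Real.exp 4 * κb ^ 2 * imagTimeWeight β M ^ 2 / cW ^ 2) ^ 3 * (ι₃ * lam ^ 2) + A' * ((4 * Real.exp 4 * κb ^ 2 * imagTimeWeight β M ^ 2 / cW ^ 2) * Q') * (((4 * Real.exp 4 * κb ^ 2 * imagTimeWeight β M ^ 2 / cW ^ 2) * lam * Q') ^ 3 / (1 - (4 * Real.exp 4 * κb ^ 2 * imagTimeWeight β M ^ 2 / cW ^ 2) * lam * Q'))) < 1)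
    (hθ : (Real.exp 1 * αb / κb ^ 2) * (Real.exp 1 * (4 * Real.exp 4 * κb ^ 2 * imagTimeWeight β M ^ 2 / cW ^ 2) * (ι₁ * lam) + (Real.exp 1 * (4 * Real.exp 4 * κb ^ 2 * imagTimeWeight β M ^ 2 / cW ^ 2)) ^ 2 * (ι₂ * lam) + (Real.exp 1 * (4 * Real.exp 4 * κb ^ 2 * imagTimeWeight β M ^ 2 / cW ^ 2)) ^ 3 * (ι₃ * lam ^ 2) + A' * (Real.exp 1 * (4 * Real.exp 4 * κb ^ 2 * imagTimeWeight β M ^ 2 / cW ^ 2) * Q') * ((Real.exp 1 * (4 * Real.exp 4 * κb ^ 2 * imagTimeWeight β M ^ 2 / cW ^ 2) * lam * Q') ^ 3 / (1 - Real.exp 1 * (4 * Real.exp 4 * κb ^ 2 * imagTimeWeight β M ^ 2 / cW ^ 2) * lam * Q'))) < 1)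
    (hxτ : (4 * Real.exp 4 * κb ^ 2 * imagTimeWeight β M ^ 2 / cW ^ 2) * lam * Q' < 1) :
    klLipBornDiffSupDT L b M β U μ K d k (n + 1) (D₀ + r) / (imagTimeWeight β M * klLevUnitF β M 0 p (d * k)) ≤
      R * ((Aν + κ₁ * lam / Q' + κ₂ / Q' ^ 2 + κ₃ / Q' ^ 3) * lam ^ (p - 1) * (4 * Q') ^ p * (4 * (κb ^ 2 * imagTimeWeight β M ^ 2 / cW ^ 2) * lam * Q' / (1 - 4 * (κb ^ 2 * imagTimeWeight β M ^ 2 / cW ^ 2) * lam * Q')) +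
        Real.exp 1 * (cW ^ 2 / (κb ^ 2 * imagTimeWeight β M ^ 2)) ^ p * ((4 * Real.exp 4 * κb ^ 2 * imagTimeWeight β M ^ 2 / cW ^ 2) * (κ₁ * lam) + (4 * Real.exp 4 * κb ^ 2 * imagTimeWeight β M ^ 2 / cW ^ 2) ^ 2 * (κ₂ * lam) + (4 * Real.exp 4 * κb ^ 2 * imagTimeWeight β M ^ 2 / cW ^ 2) ^ 3 * (κ₃ * lam ^ 2) + Aν * ((4 * Real.exp 4 * κb ^ 2 * imagTimeWeight β M ^ 2 / cW ^ 2) * Q') * (((4 * Real.exp 4 * κb ^ 2 * imagTimeWeight β M ^ 2 / cW ^ 2) * lam * Q') ^ 3 / (1 - (4 * Real.exp 4 * κb ^ 2 * imagTimeWeight β M ^ 2 / cW ^ 2) * lam * Q'))) * ((2 * ((Real.exp 1 * αb / κb ^ 2) * ((4 * Real.exp 4 * κb ^ 2 * imagTimeWeight β M ^ 2 / cW ^ 2) * (ι₁ * lam) + (4 * Real.exp 4 * κb ^ 2 * imagTimeWeight β M ^ 2 / cW ^ 2) ^ 2 * (ι₂ * lam) + (4 * Real.exp 4 * κb ^ 2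 * imagTimeWeight β M ^ 2 / cW ^ 2) ^ 3 * (ι₃ * lam ^ 2) + A' * ((4 * Real.exp 4 * κb ^ 2 * imagTimeWeight β M ^ 2 / cW ^ 2) * Q') * (((4 * Real.exp 4 * κb ^ 2 * imagTimeWeight β M ^ 2 / cW ^ 2) * lam * Q') ^ 3 / (1 - (4 * Real.exp 4 * κb ^ 2 * imagTimeWeight β M ^ 2 / cW ^ 2) * lam * Q')))) - ((Real.exp 1 * αb / κb ^ 2) * ((4 * Real.exp 4 * κb ^ 2 * imagTimeWeight β M ^ 2 / cW ^ 2) * (ι₁ * lam) + (4 * Real.exp 4 * κb ^ 2 * imagTimeWeight β M ^ 2 / cW ^ 2) ^ 2 * (ι₂ * lam) + (4 * Real.exp 4 * κb ^ 2 * imagTimeWeight β M ^ 2 / cW ^ 2) ^ 3 * (ι₃ * lam ^ 2) + A' * ((4 * Real.exp 4 * κb ^ 2 * imagTimeWeight β M ^ 2 / cW ^ 2) * Q') * (((4 * Real.exp 4 * κb ^ 2 * imagTimeWeight β M ^ 2 / cW ^ 2) * lam * Q') ^ 3 / (1 - (4 * Real.exp 4 * κb ^ 2 * imagTimeWeight β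 M ^ 2 / cW ^ 2) * lam * Q')))) ^ 2) / (1 - (Real.exp 1 * αb / κb ^ 2) * ((4 * Real.exp 4 * κb ^ 2 * imagTimeWeight β M ^ 2 / cW ^ 2) * (ι₁ * lam) + (4 * Real.exp 4 * κb ^ 2 * imagTimeWeight β M ^ 2 / cW ^ 2) ^ 2 * (ι₂ * lam) + (4 * Real.exp 4 * κb ^ 2 * imagTimeWeight β M ^ 2 / cW ^ 2) ^ 3 * (ι₃ * lam ^ 2) + A' * ((4 * Real.exp 4 * κb ^ 2 * imagTimeWeight β M ^ 2 / cW ^ 2) * Q') * (((4 * Real.exp 4 * κb ^ 2 * imagTimeWeight β M ^ 2 / cW ^ 2) * lam * Q') ^ 3 / (1 - (4 * Real.exp 4 * κb ^ 2 * imagTimeWeight β M ^ 2 / cW ^ 2) * lam * Q')))) ^ 2)) +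
      (cW ^ n * (cW * Es + cW / (1 + ΛT * ((r : ℝ) + 1)) * NDs) + (2 * cW ^ n * (cW / (1 + ΛT * ((r : ℝ) + 1))) * N + n * cW ^ n * (5 * (cW / (1 + ΛT * ((r : ℝ) + 1))) * N + 2 * cW * Nfar))) / (imagTimeWeight β M * klLevUnitF β M 0 p (d * k)) := by
  have hlink := fun (N' : ℕ) (hN' : 2 ≤ N') (hg : (Real.exp 1 * αb / κb ^ 2) * towerV D (4 * Real.exp 4 * κb ^ 2 * imagTimeWeight β M ^ 2 / cW ^ 2) (fun m => 32 * ((cW ^ 2 / 8) ^ m * (klLipInputMeasDT L M β U μ K d k jw (2 * m) / klLevUnitF β M 0 m (d * k - 1) + (klLipInputMeasDT (b * L) M β U μ K d k jw (2 * m) / klLevUnitF β M 0 m (d * k - 1) + klLipInputMeasDT L M β U μ K d k jw (2 * m) / klLevUnitF β M 0 m (d * k - 1)) + klLipInputDiffSupDT L b M β U μ K d k (2 * m) Rin / (imagTimeWeight β M * klLevUnitF β M 0 m (d * k - 1))))) < 1) =>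
    klLipBornDiffSupDT_le_kitStep_of_bounds (L := L) (b := b) (M := M) hβ U μ K jw hd hk hZf hZc hκ hκb hκκb hGB hαb hααb hrow hcol hD Rin R' hΛ1 hΛle
      jr hΛT hΛr hcW1 hrowT hcolT D₀ r hD₀ hRR' hq hN0 hNfar0 hEs0 hNDs0 hN hNfar hEs hNDs (Nt := N') (by omega) hg
  have hx : 0 < imagTimeWeight β M := imagTimeWeight_pos_of_pos (M := M) hβ
  have hΛinv : 0 ≤ Λ⁻¹ := inv_nonneg.2 (zero_le_one.trans hΛ1)
  have hν0 : ∀ m, 0 ≤ (fun m => 32 * ((cW ^ 2 / 8) ^ m * (klLipInputDiffSupDT L b M β U μ K d k (2 * m) Rin / (imagTimeWeight β M * klLevUnitF β M 0 m (d * k - 1)) + (Λ⁻¹ + 1 / (1 + ΛT * ((r : ℝ) + 1))) * (klLipInputMeasDT (b * L) M β U μ K d k jw (2 * m) / klLevUnitF β M 0 m (d * k - 1) + klLipInputMeasDT L M β U μ K d k jw (2 * m) / klLevUnitF β M 0 m (d * k - 1))))) m := fun m => by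
    have h1 := klLipInputDiffSupDT_nonneg (L := L) (b := b) (M := M) β U μ K d k (2 * m) Rin
    have h2 := klLipInputMeasDT_nonneg hβ.le U μ K d k jw (2 * m) (V := b * L) (M := M)
    have h3 := klLipInputMeasDT_nonneg hβ.le U μ K d k jw (2 * m) (V := L) (M := M)
    have h4 := klLevUnitF_pos hβ (M := M) 0 m (d * k - 1)
    have h5 : 0 ≤ cW := zero_le_one.trans hcW1
    positivity
  have hμ0 : ∀ m, 0 ≤ (fun m => 32 * ((cW ^ 2 / 8) ^ m * (klLipInputMeasDT L M β U μ K d k jw (2 * m) / klLevUnitF β M 0 m (d * k - 1) + (klLipInputMeasDT (b * L) M β U μ K d k jw (2 * m) / klLevUnitF β M 0 m (d * k - 1) + klLipInputMeasDT L M β U μ K d k jw (2 * m) / klLevUnitF β M 0 m (d * k - 1)) + klLipInputDiffSupDT L b M β U μ K d k (2 * m) Rin / (imagTimeWeight β M * klLevUnitF β M 0 m (d * k - 1))))) m := fun m => by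
    have h1 := klLipInputDiffSupDT_nonneg (L := L) (b := b) (M := M) β U μ K d k (2 * m) Rin
    have h2 := klLipInputMeasDT_nonneg hβ.le U μ K d k jw (2 * m) (V := b * L) (M := M)
    have h3 := klLipInputMeasDT_nonneg hβ.le U μ K d k jw (2 * m) (V := L) (M := M)
    have h4 := klLevUnitF_pos hβ (M := M) 0 m (d * k - 1)
    have h5 : 0 ≤ cW := zero_le_one.trans hcW1
    positivity
  exact lipStepImage_le_low' (D := D) (by omega : 1 ≤ p) (by positivity) (by positivity) (by positivity) (by positivity) (by norm_num) hlam hQ' hA' hAν hR hκ₁0 hκ₂0 hκ₃0 hν0 hμ0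
    hι₁ hι₂ hι₃ hprofb hν₁ hν₂ hν₃ hνprof hx₁ hxτ hx₃ hy₁ hθ hlink

end Summit.HubbardSuperconductivity.HubbardSuperconductivity.Theorems.TwoVolumeLip

end
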